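import Summits.Langlands.Langlands.Theses.RootDecomp1
import Summits.Langlands.Langlands.Theorems.QuadraticWindowHostInducedRepSignedTwistAux
import Summits.Langlands.Langlands.Theorems.WeightMultiplicitySplitCharpolyRoots
import Literature.NumberTheory.GaloisRepresentations.FramedGaloisRepSemisimplification
import Literature.NumberTheory.GaloisRepresentations.InducedAEUnramified
import Literature.NumberTheory.GaloisRepresentations.FramedRepBlockSum
import Literature.NumberTheory.GaloisRepresentations.IntegralGaloisActionProofs
import Literature.NumberTheory.GaloisRepresentations.SorensenPatching
import HarnessLib

/-!
# `RootDecomp1.InductionTransport` — proof of the support item stmt-Langlands-29151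

**Semisimple Satake avatars induce.**  For number fields `K ⊆ L`, `σ` cuspidal `L`-algebraic on
`GL_m/L` and `π` cuspidal `L`-algebraic on `GL_n/K` with `π` an a.e. AUTOMORPHIC INDUCTION of `σ`
(inlined: at almost every place `v` of `K`, whenever `β_w` are Satake parameters of `σ` at the
places `w ∣ v`, some Satake parameter `α` of `π` at `v` has
`∏_{a ∈ α} (X - a) = ∏_{w ∣ v} ∏_{b ∈ β_w} (X^{f(w|v)} - b)`), every semisimple avatar
`r : Γ_L → GL_m(ℚ̄_ℓ)` of `σ` yields a semisimple avatar `ρ : Γ_K → GL_n(ℚ̄_ℓ)` of `π`.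

## Proof (every input a theorem of the tree; nothing postulated, no Literature named fact)

* `ρ₁ := Ind_{Γ_L}^{Γ_K} r` (`FramedGaloisRep.induce`, rank `[L:K]·m`; `L/K` need NOT be Galois).
  At all but finitely many places `v` of `K` — those at which every inertia group above `v` lies
  in `res(Γ_L)` (`eventually_forall_inertia_le_range_absGaloisRestrict`: the permutation
  representation `Ind 1` has open kernel) and below no exceptional place of `r` — `ρ₁` is
  unramified (`FramedGaloisRep.isUnramifiedAt_induce`) with Frobenius characteristic polynomial
  `∏_{w ∣ v} P_w(X^{f(w|v)})`, `P_w = arithFrobPolyOfSatake ι q_w 1 β_w` the Frobenius polynomial of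
  `r` at `w` (`FramedGaloisRep.hasFrobCharpolyAt_induce`; Mackey's double-coset formula for the
  characteristic polynomial of an induced matrix, Neukirch VII §10 (10.4)(iv)).
* The host-polynomial identity `∏_{w ∣ v} P_w(X^{f(w|v)}) = arithFrobPolyOfSatake ι q_v 1 α` for
  the induced Satake parameter `α` (`HostInducedRep.GrsExplicitDescent.hostPoly_eq_arithFrobPolyOfSatake`,
  trivial twist): the `f(w|v)`-th roots of the `b⁻¹`, `b ∈ β_w`, are the `a⁻¹`, `a^{f(w|v)} = b`.
* Rank: at one good place (there are infinitely many places) the Frobenius characteristic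
  polynomial of `ρ₁` has degree `[L:K]·m` and equals `arithFrobPolyOfSatake ι q_v 1 α` of degree
  `#α = n`; so `[L:K]·m = n` and `ρ₁` is relabelled to rank `n` (`FramedRep.reindex (finCongr _)`).
* `ρ :=` the SEMISIMPLIFICATION of the relabelled `ρ₁` (`FramedGaloisRep.exists_semisimplification`,
  Deligne–Serre 1974, 6.12): same Frobenius characteristic polynomials, unramified wherever `ρ₁`
  is — so the semisimplicity hypothesis on `r` is not even used.

References: Arthur–Clozel, *Simple algebras, base change, and the advanced theory of the trace
formula* (1989), Ch. 3 §6 (automorphic induction, (6.1)–(6.2)); Serre, *Abelian ℓ-adic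
representations* (1968), Ch. I §2.3; Neukirch, *Algebraic Number Theory*, VII §10 (10.4);
Deligne–Serre, *Formes modulaires de poids 1*, ASENS 7 (1974), 6.12.
-/

noncomputable section

set_option linter.dupNamespace false

open scoped NumberField Classical Polynomial
open Filter IsDedekindDomain Polynomial
open Literature.NumberTheory.Automorphic Literature.NumberTheory.GaloisRepresentations
open Summit.Langlands.Langlands.Theorems.HostInducedRep.GrsExplicitDescent (hostPoly
  hostPoly_eq_arithFrobPolyOfSatake setOf_asIdeal_under_eq)

namespace Summit.Langlands.Langlands.Theorems

/-- **`RootDecomp1.InductionTransport` holds** (stmt-Langlands-29151): semisimple Satake avatars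
are transported along a.e. automorphic induction `σ ↦ π = AI_{L/K}(σ)` by
`r ↦ (Ind_{Γ_L}^{Γ_K} r)^{ss}`.  See the module docstring for the proof.
[cite: ArthurClozel1989, Ch. 3 §6] -/
theorem inductionTransport_proof :
    Summit.Langlands.Langlands.Theses.RootDecomp1.InductionTransport := by
  intro K _ _ L _ _ _ m n hL hcpt hm hn σ π hσ hπ hrel ℓ _ ι r hss hr
  classical
  haveI : FiniteDimensional K L := Module.Finite.of_restrictScalars_finite ℚ K L
  -- a global choice of Satake parameters `β w` of `σ`, compatible with `r` wherever possible
  have hβex : ∀ w : HeightOneSpectrum (𝓞 L), ∃ β : Multiset ℂ,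
      SatakeFrobCompatibleAt ι σ.1 r w → σ.1.HasSatakeParamAt w β ∧ r.IsUnramifiedAt w ∧
        r.HasFrobCharpolyAt w (arithFrobPolyOfSatake ι w.residueCard 1 β) := by
    intro w
    by_cases h : SatakeFrobCompatibleAt ι σ.1 r w
    · obtain ⟨β, hβ⟩ := h
      exact ⟨β, fun _ => hβ⟩
    · exact ⟨∅, fun h' => absurd h' h⟩
  choose β hβ using hβex
  -- the induced representation, of rank `[L:K]·m`
  set d : ℕ := Module.finrank K L with hd
  set ρ₁ : FramedGaloisRep K (PadicAlgCl ℓ) (d * m) := r.induce K hd.symm with hρ₁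
  -- (1) Frobenius polynomials of `Ind r` a.e.
  have hP : ∀ᶠ w : HeightOneSpectrum (𝓞 L) in cofinite,
      r.HasFrobCharpolyAt w (arithFrobPolyOfSatake ι w.residueCard 1 (β w)) :=
    hr.mono fun w hw => (hβ w hw).2.2
  have hchar : ∀ᶠ v : HeightOneSpectrum (𝓞 K) in cofinite, ρ₁.HasFrobCharpolyAt v
      (inducedFrobPolynomial v fun w => arithFrobPolyOfSatake ι w.residueCard 1 (β w)) :=
    FramedGaloisRep.eventually_hasFrobCharpolyAt_induce K hd.symm r hP
  -- (2) unramifiedness of `Ind r` a.e.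
  have hunr : ∀ᶠ v : HeightOneSpectrum (𝓞 K) in cofinite, ρ₁.IsUnramifiedAt v :=
    FramedGaloisRep.eventually_isUnramifiedAt_induce K hd.symm r (hr.mono fun w hw => (hβ w hw).2.1)
  -- (3) "a.e. `w`" to "a.e. `v`, every `w ∣ v`"
  have habove : ∀ᶠ v : HeightOneSpectrum (𝓞 K) in cofinite, ∀ w : HeightOneSpectrum (𝓞 L),
      w.asIdeal.under (𝓞 K) = v.asIdeal → SatakeFrobCompatibleAt ι σ.1 r w := by
    rw [Filter.eventually_cofinite] at hr ⊢
    refine (hr.image fun w => w.under (𝓞 K)).subset fun v hv => ?_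
    simp only [Set.mem_setOf_eq, not_forall] at hv
    obtain ⟨w, hw, hbad⟩ := hv
    exact ⟨w, hbad, HeightOneSpectrum.ext hw⟩
  -- (4) the good places: `π` and `Ind r` are Satake–Frobenius compatible there
  have hgood : ∀ᶠ v : HeightOneSpectrum (𝓞 K) in cofinite, ∃ α : Multiset ℂ,
      π.1.HasSatakeParamAt v α ∧ ρ₁.IsUnramifiedAt v ∧
        ρ₁.HasFrobCharpolyAt v (arithFrobPolyOfSatake ι v.residueCard 1 α) := by
    filter_upwards [hchar, hunr, habove, hrel] with v hv₁ hv₂ hv₃ hv₄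
    obtain ⟨α, hπα, hpoly⟩ := hv₄ β fun w hw => (hβ w (hv₃ w hw)).1
    refine ⟨α, hπα, hv₂, ?_⟩
    -- the host-polynomial identity
    have hβ1 : (fun w : HeightOneSpectrum (𝓞 L) => (β w).map (fun a => a * (1 : ℂ))) = β := by
      funext w
      rw [show (fun a : ℂ => a * 1) = id from funext fun a => mul_one a, Multiset.map_id]
    have hB : satakePolynomial α =
        inducedSatakePolynomial v (fun w => (β w).map (fun a => a * (1 : ℂ))) := by
      rw [hβ1]
      exact hpoly
    have hhost := hostPoly_eq_arithFrobPolyOfSatake ι 1 β (fun _ => (1 : ℂ)) v α hB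
    have hkey : inducedFrobPolynomial v (fun w => arithFrobPolyOfSatake ι w.residueCard 1 (β w)) =
        arithFrobPolyOfSatake ι v.residueCard 1 α := by
      rw [← hhost, hostPoly, inducedFrobPolynomial, setOf_asIdeal_under_eq]
      refine finprod_mem_congr rfl fun w _ => ?_
      rw [Polynomial.expand_eq_comp_X_pow, congrFun hβ1 w]
    rw [← hkey]
    exact hv₁
  -- (5) the rank: `[L:K]·m = n`, read off at one good place
  haveI : Infinite (HeightOneSpectrum (𝓞 K)) := SorensenPatching.infinite_heightOneSpectrum K
  obtain ⟨v₀, α₀, hπα₀, -, hcp₀⟩ := hgood.exists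
  have hdm : d * m = n := by
    obtain ⟨𝔓, h𝔓⟩ := v₀.primesAbove_nonempty
    obtain ⟨g, hg⟩ := HeightOneSpectrum.exists_isArithFrobAt_of_mem_primesAbove_holds h𝔓
    have h := congrArg Polynomial.natDegree (hcp₀ 𝔓 h𝔓 g hg)
    rwa [CharpolyRoots.natDegree_charpoly, natDegree_arithFrobPolyOfSatake, hπα₀.card_eq] at h
  -- (6) relabel to rank `n` and semisimplify
  obtain ⟨ρ, hρss, -, -, hur_ρ, hcp_ρ⟩ := FramedGaloisRep.exists_semisimplification
    (FramedRep.reindex (finCongr hdm) ρ₁ : FramedGaloisRep K (PadicAlgCl ℓ) n)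
  refine ⟨ρ, hρss, ?_⟩
  filter_upwards [hgood] with v hv
  obtain ⟨α, hπα, hur, hcp⟩ := hv
  exact ⟨α, hπα, hur_ρ v ((FramedGaloisRep.isUnramifiedAt_reindex_iff v (finCongr hdm) ρ₁).2 hur),
    hcp_ρ v _ ((FramedGaloisRep.hasFrobCharpolyAt_reindex_iff v (finCongr hdm) ρ₁ _).2 hcp)⟩

end Summit.Langlands.Langlands.Theorems
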